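import Summits.AtomisticToContinuum.HydrodynamicLimit.Theorems.CollisionIsometryCLTMacroClosureEngineTrajectoryIntegrable
import Summits.AtomisticToContinuum.HydrodynamicLimit.Theorems.CollisionIsometryCLTMacroClosureEngineReadoutA
import Summits.AtomisticToContinuum.HydrodynamicLimit.Theorems.CollisionIsometryCLTMacroClosureStubClausiusLimits
import HarnessLib

/-!
# Sub-goal `engine_relEntTimeIntegrable` of the lead's `engine_incrementBound` (line `IdeatorTwoGen1Sketch`,
# crux `MacroClosure`, stmt-AtomisticToContinuum-14870): time-integrability of the block relative entropy

For a classical hs-Euler solution `(ρ, u, θ)` on `[0, T)` in the dilute chamber of `ThermoChamber η₃`,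
`0 < t < T`, a band floor `c₁ > 0`, a smooth kernel `0 ≤ φ ≤ Φb` with `Φb < (N+1) c₁`, and ONE good
trajectory `τ ↦ w_τ := Φ_τ z` of a hard-sphere flow whose blocks stay in the band `c₁ ≤ ρ̄ ≤ σ⁻³` on `[0, t]`
and whose velocities are pairwise distinct at every `τ ∈ [0, t]`, the block relative-entropy functional
`X(τ) := ∫ₓ h_σ(Ū(φ, w_τ, x) | U_cl(τ, x)) dx` is integrable on `[0, t]` (the pathwise input of the Tonelli
step of the increment bound).

Proof. The subtlety is the term `−(3/2) ρ̄ log θ̄` of `η_σ(Ū)`, unbounded on cold blocks; it is controlled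
window by window. On a collision-free window `(a, b) ⊆ [0, t]` the trajectory agrees with the CONTINUOUS path
of configurations `W(s) = (xᵢ(clamp s), vᵢ(m))ᵢ` (positions clamped to `[a, b]`, velocities frozen at the
midpoint `m`); every block of every `W(s)` lies in the band (the band depends on positions only, and the
clamped positions are true positions at a time of `[a, b] ⊆ [0, t]`) and carries two particles with distinct
velocities (one particle weighs at most `(N+1)⁻¹ Φb < c₁ ≤ ρ̄`; the frozen velocities are those at
`m ∈ [0, t]`), so its block temperature is positive (`EngineReadout.strict_of_band`). Hence
`(s, x) ↦ η_σ(Ū(φ, W s, x))` is jointly continuous on `ℝ × 𝕋³` (`f_ex` is continuous on the band by Ruelle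
convexity, `HsFreeEnergyConvex`), and with the jointly smooth classical data `η_σ ∘ U_cl`, `U_cl`,
`Λ_cl = Dη_σ ∘ U_cl` on `[0, T) × 𝕋³` the relative entropy density
`h_σ(Ū | U_cl) = η_σ(Ū) − η_σ(U_cl) − Λ_cl (Ū − U_cl)` is jointly continuous on the compact `[a, b] × 𝕋³`,
so integrable there, and by Fubini `s ↦ ∫ₓ h_σ(Ū(W s) | U_cl(s))` is integrable on `[a, b]`. The finitely
many windows are glued by induction on the collision set (`EngineTrajectoryIntegrable.integrableOn_Icc_of_pieces`).
-/

noncomputable section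

open MeasureTheory Filter Set Topology InformationTheory
open scoped ENNReal ContDiff

namespace Summit.AtomisticToContinuum.HydrodynamicLimit.Theorems.MacroClosureLine

open Literature.MathematicalPhysics.KineticTheory Literature.Analysis.FluidPDE
open Literature.Analysis.FunctionSpaces
open Summit.AtomisticToContinuum.HydrodynamicLimit.Theses

namespace Barycentric

namespace EngineRelEntTimeIntegrable

/-! ## Continuity of the hs entropy along a continuous family of strict band states -/

/-- **Continuity of `η_σ` along a continuous family of band states with positive temperature**: if
`p ↦ V(p)` is continuous, `c₁ ≤ V.ρ ≤ σ⁻³` and `θ(V) > 0` everywhere, and `f_ex` is continuous on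
`[c₁σ³, 1]`, then `p ↦ η_σ(V(p)) = −V.ρ ((3/2) log θ(V) − log V.ρ − f_ex(V.ρ σ³))` is continuous
(as `Clausius.continuous_hsEntropy_bU`, for an arbitrary parameter space). -/
theorem continuous_hsEntropy_comp {P : Type*} [TopologicalSpace P] {σ c₁ : ℝ} (hσ : 0 < σ)
    (hc₁ : 0 < c₁) (hfex : ContinuousOn hsExcessFreeEnergy (Icc (c₁ * σ ^ 3) 1)) {V : P → State}
    (hV : Continuous V) (hband : ∀ p, c₁ ≤ (V p).1 ∧ (V p).1 * σ ^ 3 ≤ 1)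
    (hθ : ∀ p, 0 < stateTemp (V p)) : Continuous fun p => hsEntropy σ (V p) := by
  have hρ : Continuous fun p => (V p).1 := hV.fst
  have hρ0 : ∀ p, (V p).1 ≠ 0 := fun p => (hc₁.trans_le (hband p).1).ne'
  have hm : Continuous fun p => (V p).2.1 := hV.snd.fst
  have hE : Continuous fun p => (V p).2.2 := hV.snd.snd
  have hT : Continuous fun p => stateTemp (V p) := by
    unfold stateTemp
    refine continuous_const.mul ((hE.div hρ hρ0).sub ((hm.norm.pow 2).div
      (continuous_const.mul (hρ.pow 2)) fun p => ?_))
    exact mul_ne_zero two_ne_zero (pow_ne_zero 2 (hρ0 p))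
  have hfe : Continuous fun p => hsExcessFreeEnergy ((V p).1 * σ ^ 3) :=
    hfex.comp_continuous (hρ.mul continuous_const) fun p =>
      ⟨mul_le_mul_of_nonneg_right (hband p).1 (pow_nonneg hσ.le 3), (hband p).2⟩
  have hrepr : (fun p => hsEntropy σ (V p)) = fun p =>
      -((V p).1 * (3 / 2 * Real.log (stateTemp (V p)) - Real.log (V p).1 -
        hsExcessFreeEnergy ((V p).1 * σ ^ 3))) := rfl
  rw [hrepr]
  exact (hρ.mul ((((hT.log fun p => (hθ p).ne').const_mul _).sub (hρ.log hρ0)).sub hfe)).neg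

/-! ## Frozen velocities on a collision-free window -/

section Trajectory

variable {N : ℕ} {ε : ℝ} {γ : ℝ → Config (N + 1) (Fin 3) T3}

/-- **Frozen velocities on a collision-free window** (as `EngineTrajectoryIntegrable.exists_frozen`, also
recording the velocities). On a collision-free `(a, b)` the trajectory agrees with a CONTINUOUS path of
configurations (positions clamped to `[a, b]`, velocities frozen at the midpoint `(a + b)/2`), whose
positions at every time are those of the trajectory at some time of `[a, b]` and whose velocities at every
time are those of the trajectory at the midpoint. -/
theorem exists_frozen_vel (hγ : IsHardSphereTrajectory (Torus.geometry (Fin 3)) ε (N + 1) γ) {a b : ℝ}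
    (hab : a < b) (hfree : ∀ τ ∈ Ioo a b, τ ∉ collisionTimes (Torus.geometry (Fin 3)) ε γ) :
    ∃ W : ℝ → Config (N + 1) (Fin 3) T3, Continuous W ∧ (∀ s ∈ Ioo a b, γ s = W s) ∧
      (∀ s, ∃ τ ∈ Icc a b, ∀ i, (W s i).1 = (γ τ i).1) ∧
      ∀ s i, (W s i).2 = (γ ((a + b) / 2) i).2 := by
  have hcl : Continuous fun s : ℝ => max a (min s b) :=
    continuous_const.max (continuous_id.min continuous_const)
  refine ⟨fun s i => ((γ (max a (min s b)) i).1, (γ ((a + b) / 2) i).2), ?_, ?_, ?_, fun s i => rfl⟩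
  · exact continuous_pi fun i => ((hγ.pos_continuous i).comp hcl).prodMk continuous_const
  · intro s hs
    have hm : (a + b) / 2 ∈ Ioo a b := ⟨by linarith [hs.1, hs.2], by linarith [hs.1, hs.2]⟩
    have hc : max a (min s b) = s := by rw [min_eq_left hs.2.le, max_eq_right hs.1.le]
    funext i
    simp only [hc]
    rw [← traj_vel_eq_of_free hγ hfree hm hs i]
  · intro s
    exact ⟨max a (min s b), ⟨le_max_left _ _, max_le hab.le (min_le_right _ _)⟩, fun i => rfl⟩

end Trajectory

/-! ## The block relative entropy along a continuous strict band path -/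

section Solution

variable {σ η₃ T : ℝ} {ρ θ : ℝ → T3 → ℝ} {u : ℝ → T3 → V3} {N : ℕ}

/-- **The block relative entropy along a continuous strict band path is integrable in time**
(`[a, b] ⊆ [0, t]`, `t < T`): if `W` is a continuous path of configurations all of whose blocks lie in
the band `c₁ ≤ ρ̄ ≤ σ⁻³` and have positive block temperature, then
`(s, x) ↦ h_σ(Ū(φ, W s, x) | U_cl(s, x))` is jointly continuous on the compact `[a, b] × 𝕋³` (block
entropy by `continuous_hsEntropy_comp`; classical entropy, state and entropy variables are jointly smooth
on `[0, T) × 𝕋³`), hence integrable there, and by Fubini `s ↦ ∫ₓ h_σ(Ū(W s) | U_cl(s))` is integrable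
on `[a, b]`. -/
theorem integrableOn_window (hH : StiffCollisionalRelaxation.HsFreeEnergyConvex) (hσ : 0 < σ)
    (hE : IsHardSphereEulerSolution σ T ρ u θ) (hT : ThermoChamber η₃)
    (hpack : ∀ s ∈ Ico 0 T, ∀ x, ρ s x * σ ^ 3 < η₃) {t : ℝ} (htT : t < T) {c₁ : ℝ} (hc₁ : 0 < c₁)
    {φ : T3 → ℝ} (hφc : Continuous φ) {W : ℝ → Config (N + 1) (Fin 3) T3} (hW : Continuous W)
    (hband : ∀ s x, c₁ ≤ bρ φ (W s) x ∧ bρ φ (W s) x * σ ^ 3 ≤ 1)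
    (hθpos : ∀ s x, 0 < stateTemp (bU φ (W s) x)) {a b : ℝ} (ha : 0 ≤ a) (hb : b ≤ t) :
    IntegrableOn (fun s => ∫ x, relEnt σ (bU φ (W s) x) (Ucl ρ θ u s x)) (Icc a b) := by
  obtain ⟨hΛ, -⟩ := EngineBlockClosure.lam_smooth hσ hE hT hpack
  have hK : IsCompact (Icc a b ×ˢ (univ : Set T3)) := isCompact_Icc.prod isCompact_univ
  have hKS : Icc a b ×ˢ (univ : Set T3) ⊆ Ico 0 T ×ˢ univ :=
    prod_mono (fun s hs => ⟨ha.trans hs.1, (hs.2.trans hb).trans_lt htT⟩) subset_rfl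
  have hfex : ContinuousOn hsExcessFreeEnergy (Icc (c₁ * σ ^ 3) 1) :=
    (Clausius.continuousOn_hsExcessFreeEnergy hH).mono fun r hr =>
      ⟨(mul_pos hc₁ (pow_pos hσ 3)).trans_le hr.1, hr.2.trans_lt (by norm_num)⟩
  -- joint continuity of the block state and of the block entropy along the path
  have hw : Continuous fun p : ℝ × T3 => W p.1 := hW.comp continuous_fst
  obtain ⟨hρc, hmc, hEc⟩ := EngineTrajectoryIntegrable.continuous_pathBlocks hφc hw continuous_snd
  have hbU : Continuous fun p : ℝ × T3 => bU φ (W p.1) p.2 := hρc.prodMk (hmc.prodMk hEc)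
  have hηV : Continuous fun p : ℝ × T3 => hsEntropy σ (bU φ (W p.1) p.2) :=
    continuous_hsEntropy_comp hσ hc₁ hfex hbU (fun p => hband p.1 p.2) fun p => hθpos p.1 p.2
  -- joint continuity of the classical data on `[a, b] × 𝕋³`
  have cηU : ContinuousOn (fun p : ℝ × T3 => hsEntropy σ (Ucl ρ θ u p.1 p.2)) (Icc a b ×ˢ univ) :=
    (continuousOn_uncurry_of_stLift
      (EngineIsentropic.isSmoothSpaceTimeOn_entropy hσ hT hE hpack).continuousOn_stLift).mono hKS
  have cU : ContinuousOn (fun p : ℝ × T3 => Ucl ρ θ u p.1 p.2) (Icc a b ×ˢ univ) :=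
    (continuousOn_uncurry_of_stLift (isSmoothSpaceTimeOn_stateOf hE).continuousOn_stLift).mono hKS
  have cΛ : ContinuousOn (fun p : ℝ × T3 => fderiv ℝ (hsEntropy σ) (Ucl ρ θ u p.1 p.2))
      (Icc a b ×ˢ univ) :=
    (continuousOn_uncurry_of_stLift hΛ.continuousOn_stLift).mono hKS
  have hG : ContinuousOn (fun p : ℝ × T3 => relEnt σ (bU φ (W p.1) p.2) (Ucl ρ θ u p.1 p.2))
      (Icc a b ×ˢ univ) := by
    unfold relEnt
    exact (hηV.continuousOn.sub cηU).sub (cΛ.clm_apply (hbU.continuousOn.sub cU))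
  exact EngineTrajectoryIntegrable.integrableOn_integral_Icc (hG.integrableOn_compact hK)

end Solution

end EngineRelEntTimeIntegrable

open EngineTrajectoryIntegrable EngineRelEntTimeIntegrable in
/-- **`engine_relEntTimeIntegrable` (registered sub-goal S4 of the lead's `engine_incrementBound`):
time-integrability of the block relative entropy along one good trajectory.** For a classical solution
in the chamber of `ThermoChamber η₃`, `0 < t < T`, a band floor `c₁`, a smooth kernel `0 ≤ φ ≤ Φb` with
`Φb < (N+1) c₁`, and a good trajectory `τ ↦ Φ_τ z` whose blocks stay in the band on `[0, t]` and whose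
velocities are pairwise distinct at every `τ ∈ [0, t]`, the functional `τ ↦ ∫ₓ h_σ(Ū(φ, Φ_τ z, x) | U_cl(τ, x)) dx`
is integrable on `[0, t]` (frozen velocities on collision-free windows: two particles with distinct
velocities per band block give a positive block temperature, so the relative entropy density is jointly
continuous on each closed window; Fubini; gluing of the finitely many windows). -/
theorem engine_relEntTimeIntegrable : ∀ (σ : ℝ), 0 < σ → StiffCollisionalRelaxation.HsFreeEnergyConvex → ∀ (T : ℝ) (ρ θ : ℝ → T3 → ℝ) (u : ℝ → T3 → V3), IsHardSphereEulerSolution σ T ρ u θ → ∀ η₃ : ℝ, ThermoChamber η₃ → (∀ s ∈ Ico 0 T, ∀ x, ρ s x * σ ^ 3 < η₃) → ∀ t : ℝ, 0 < t → t < T → ∀ c₁ : ℝ, 0 < c₁ → c₁ * σ ^ 3 ≤ 1 → ∀ (N : ℕ) (Φ : Flow σ N) (φ : T3 → ℝ) (Φb : ℝ), Torus.IsSmooth φ → (∀ y, 0 ≤ φ y) → (∀ y, φ y ≤ Φb) → Φb < ((N + 1 : ℕ) : ℝ) * c₁ → ∀ z ∈ Φ.good, (∀ τ ∈ Icc 0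 t, ∀ x, c₁ ≤ bρ φ (Φ.flow τ z) x ∧ bρ φ (Φ.flow τ z) x * σ ^ 3 ≤ 1) → (∀ τ ∈ Icc 0 t, ∀ i j : Fin (N + 1), i ≠ j → (Φ.flow τ z i).2 ≠ (Φ.flow τ z j).2) → IntegrableOn (fun τ => ∫ x, relEnt σ (bU φ (Φ.flow τ z) x) (Ucl ρ θ u τ x)) (Icc 0 t) := by
  intro σ hσ hH T ρ θ u hE η₃ hT hpack t ht htT c₁ hc₁ _hc₁σ N Φ φ Φb hφ hφ0 hφb hNb z hz hband hvel
  have hφc : Continuous φ := hφ.continuous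
  have hγ : IsHardSphereTrajectory (Torus.geometry (Fin 3)) (hsDiameter σ N) (N + 1)
      fun s => Φ.flow s z :=
    Φ.isTrajectory z hz
  refine integrableOn_Icc_of_pieces hγ ht.le fun a b ha hab hb hfree => ?_
  -- the frozen path on the window: band blocks with two distinct velocities each
  obtain ⟨W, hW, hγW, hWpos, hWvel⟩ := exists_frozen_vel hγ hab hfree
  have hm : (a + b) / 2 ∈ Icc (0 : ℝ) t := ⟨by linarith, by linarith⟩
  have hbandW : ∀ s x, c₁ ≤ bρ φ (W s) x ∧ bρ φ (W s) x * σ ^ 3 ≤ 1 := by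
    intro s x
    obtain ⟨τ, hτ, hpos⟩ := hWpos s
    have h : bρ φ (W s) x = bρ φ (Φ.flow τ z) x := by simp only [bρ_eq_sum, hpos]
    rw [h]
    exact hband τ ⟨ha.trans hτ.1, hτ.2.trans hb⟩ x
  have hvelW : ∀ s, ∀ i j : Fin (N + 1), i ≠ j → (W s i).2 ≠ (W s j).2 := by
    intro s i j hij
    rw [hWvel s i, hWvel s j]
    exact hvel _ hm i j hij
  have hθpos : ∀ s x, 0 < stateTemp (bU φ (W s) x) := fun s x =>
    (EngineReadout.strict_of_band hφ0 hφb hNb (hbandW s) (hvelW s) x).2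
  -- integrability along the frozen path on the closed window, and agreement on the open window
  have h := integrableOn_window hH hσ hE hT hpack htT hc₁ hφc hW hbandW hθpos ha hb
  exact (h.mono_set Ioo_subset_Icc_self).congr_fun (fun s hs => by simp only [hγW s hs])
    measurableSet_Ioo

end Barycentric

end Summit.AtomisticToContinuum.HydrodynamicLimit.Theorems.MacroClosureLine

end
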